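import Literature.AlgebraicGeometry.Resolution.ResidueFieldsIntegralMorphisms
import Literature.AlgebraicGeometry.Resolution.ComponentsUnderIntegralFlat
import Mathlib.AlgebraicGeometry.Fiber
import Mathlib.AlgebraicGeometry.Geometrically.Connected
import Mathlib.AlgebraicGeometry.Morphisms.ClosedImmersion
import HarnessLib

/-!
# Fibres of a base change and of a reduction: components, dimension, density, connectedness

Topic: `Literature/AlgebraicGeometry/Resolution`. Generic scheme theory serving de Jong 1996, 4.15
(`AlterationsStrictTransform.lean`, `AlterationsSectionsReduction.lean`): for `f : X → Y`,
`ψ : Y' → Y` and a surjective closed immersion `ι : X' → X ×_Y Y'` (the reduction), the new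
fibration is `f' = ι ≫ pr_{Y'}`, and "(vi) a) All fibres are nonempty, geometrically connected
and equidimensional of dimension 1. (vi) b) The smooth locus of `f` is dense in all fibres" must
pass from `f` to `f'`. Everything here is PROVED:

* the fibre of `pr_{Y'} : X ×_Y Y' → Y'` at `y'` is the base change of the fibre of `f` at
  `ψ y'` along `Spec κ(y') → Spec κ(ψ y')` (`exists_isPullback_fiber_snd`: a cartesian square
  with the comparison morphism `π`, compatible with the embeddings into `X`); `π` is flat and
  surjective, and integral when `ψ` is integral
  (`Scheme.Hom.isIntegralHom_SpecMap_residueFieldMap`);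
* the fibre of `ι ≫ p` at `y'` maps to the fibre of `p` by a surjective closed immersion
  (`exists_fiber_comp_of_isClosedImmersion`), a homeomorphism; surjective closed immersions
  are homeomorphisms and transport "every irreducible component has dimension `d`" and the
  density of preimages (`IsHomeomorph` lemmas);
* consequences for `f' = ι ≫ pr_{Y'}` with `ψ` integral: if every irreducible component of every
  fibre of `f` has dimension `d`, so does every irreducible component of every fibre of `f'`
  (`topologicalKrullDim_irreducibleComponents_fiber_comp_snd`); preimages in the fibres of `f'`
  of opens of `X` whose traces on the fibres of `f` are dense are dense
  (`dense_preimage_fiberι_comp_snd`); `f'` is geometrically connected if `f` is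
  (`geometricallyConnected_comp_of_isClosedImmersion_of_surjective`).

## Sources

* The Stacks Project, Tag 0ECG, Tag 03HV, Tag 0362 (geometrically connected), Tag 01JT (fibres
  and base change).
-/

noncomputable section

open CategoryTheory CategoryTheory.Limits AlgebraicGeometry TopologicalSpace Topology

namespace Literature.AlgebraicGeometry.Resolution

universe u

/-! ## Surjective closed immersions are homeomorphisms -/

section SurjectiveClosedImmersion

variable {X' P : Scheme.{u}} (ι : X' ⟶ P) [IsClosedImmersion ι] [Surjective ι]

/-- A surjective closed immersion is a homeomorphism on underlying spaces. [folklore] -/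
theorem isHomeomorph_of_isClosedImmersion_of_surjective : IsHomeomorph ι :=
  isHomeomorph_iff_isEmbedding_surjective.mpr ⟨ι.isClosedEmbedding.isEmbedding, ι.surjective⟩

end SurjectiveClosedImmersion

/-! ## Homeomorphisms: components, dimension and density -/

section Homeomorph

variable {α β : Type*} [TopologicalSpace α] [TopologicalSpace β] {e : α → β} (he : IsHomeomorph e)

include he in
/-- A homeomorphism of sober `T₀` spaces transports "every irreducible component has dimension
`d`". [folklore] -/
theorem IsHomeomorph.topologicalKrullDim_irreducibleComponents [QuasiSober α] [T0Space α]
    [QuasiSober β] [T0Space β] {d : WithBot ℕ∞}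
    (h : ∀ C ∈ irreducibleComponents β, topologicalKrullDim C = d) :
    ∀ C' ∈ irreducibleComponents α, topologicalKrullDim C' = d := by
  intro C' hC'
  have h1 : e '' C' ∈ irreducibleComponents β :=
    image_mem_irreducibleComponents_of_isClosedMap_of_generalizingMap he.continuous he.isClosedMap
      he.isOpenEmbedding.generalizingMap hC'
  rw [topologicalKrullDim_image_eq_of_isClosedMap he.continuous he.isClosedMap
    (fun a b _ hab => he.injective hab) (isClosed_of_mem_irreducibleComponents C' hC')]
  exact h _ h1

include he in
/-- Preimages of dense sets under homeomorphisms are dense. [folklore] -/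
theorem IsHomeomorph.dense_preimage {D : Set β} (hD : Dense D) : Dense (e ⁻¹' D) :=
  hD.preimage he.isOpenMap

end Homeomorph

/-! ## The fibre of a composite with a closed immersion -/

section FiberComp

variable {X' P S : Scheme.{u}} (ι : X' ⟶ P) (p : P ⟶ S) (s : S)

/-- **The fibre of `ι ≫ p` at `s` maps to the fibre of `p` by a base change of `ι`**: there is
`m : (ι ≫ p)_s → p_s` over `ι` (`m ≫ p.fiberι s = (ι ≫ p).fiberι s ≫ ι`) which is a closed
immersion if `ι` is, and surjective if `ι` is. [folklore] -/
theorem exists_fiber_comp_of_isClosedImmersion [IsClosedImmersion ι] [Surjective ι] :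
    ∃ m : (ι ≫ p).fiber s ⟶ p.fiber s, IsClosedImmersion m ∧ Surjective m ∧
      m ≫ p.fiberι s = (ι ≫ p).fiberι s ≫ ι := by
  let m : (ι ≫ p).fiber s ⟶ p.fiber s :=
    pullback.map (ι ≫ p) (S.fromSpecResidueField s) p (S.fromSpecResidueField s) ι (𝟙 _) (𝟙 _)
      ((Category.comp_id _).trans rfl) ((Category.comp_id _).trans (Category.id_comp _).symm)
  refine ⟨m, ?_, ?_, ?_⟩
  · exact MorphismProperty.pullbackMap (P := @IsClosedImmersion) inferInstance inferInstance rfl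
      (Category.id_comp _).symm
  · exact MorphismProperty.pullbackMap (P := @Surjective) inferInstance inferInstance rfl
      (Category.id_comp _).symm
  · exact pullback.lift_fst _ _ _

end FiberComp

/-! ## The fibre of a base change -/

section FiberSnd

variable {X Y Y' : Scheme.{u}} (f : X ⟶ Y) (ψ : Y' ⟶ Y) (y' : Y')

/-- **The fibre of `pr_{Y'} : X ×_Y Y' → Y'` at `y'` is the base change of the fibre of `f` at
`ψ y'` along `Spec κ(y') → Spec κ(ψ y')`**: there is `π : (pr_{Y'})_{y'} → X_{ψ y'}` making the
square with the two structure morphisms to `Spec κ(y')`, `Spec κ(ψ y')` cartesian and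
compatible with the embeddings into `X` (`π ≫ f.fiberι (ψ y') = pr_{y'}.fiberι ≫ pr_X`).
[cite: StacksProject, Tag 01JT] -/
theorem exists_isPullback_fiber_snd :
    ∃ π : (pullback.snd f ψ).fiber y' ⟶ f.fiber (ψ y'),
      IsPullback π ((pullback.snd f ψ).fiberToSpecResidueField y')
          (f.fiberToSpecResidueField (ψ y')) (Spec.map (ψ.residueFieldMap y')) ∧
        π ≫ f.fiberι (ψ y') = (pullback.snd f ψ).fiberι y' ≫ pullback.fst f ψ := by
  -- the fibre squares and the base-change square
  have hA : IsPullback ((pullback.snd f ψ).fiberι y')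
      ((pullback.snd f ψ).fiberToSpecResidueField y') (pullback.snd f ψ)
      (Y'.fromSpecResidueField y') := IsPullback.of_hasPullback _ _
  have hB : IsPullback (pullback.fst f ψ) (pullback.snd f ψ) f ψ := IsPullback.of_hasPullback _ _
  have hC : IsPullback (f.fiberι (ψ y')) (f.fiberToSpecResidueField (ψ y')) f
      (Y.fromSpecResidueField (ψ y')) := IsPullback.of_hasPullback _ _
  -- the rectangle over `Spec κ(y') → Y' → Y = Spec κ(y') → Spec κ(ψ y') → Y`
  have hAB := hA.paste_horiz hB
  rw [← Scheme.Hom.SpecMap_residueFieldMap_fromSpecResidueField] at hAB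
  -- the comparison morphism
  let π : (pullback.snd f ψ).fiber y' ⟶ f.fiber (ψ y') :=
    hC.lift ((pullback.snd f ψ).fiberι y' ≫ pullback.fst f ψ)
      ((pullback.snd f ψ).fiberToSpecResidueField y' ≫ Spec.map (ψ.residueFieldMap y'))
      (by simpa only [Category.assoc] using hAB.w)
  have h1 : π ≫ f.fiberι (ψ y') = (pullback.snd f ψ).fiberι y' ≫ pullback.fst f ψ :=
    hC.lift_fst _ _ _
  have h2 : π ≫ f.fiberToSpecResidueField (ψ y') =
      (pullback.snd f ψ).fiberToSpecResidueField y' ≫ Spec.map (ψ.residueFieldMap y') :=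
    hC.lift_snd _ _ _
  refine ⟨π, ?_, h1⟩
  rw [← h1] at hAB
  exact IsPullback.of_right hAB h2 hC

/-- `Spec` of a homomorphism out of a field is flat. [folklore] -/
theorem flat_SpecMap_of_field {K : Type u} [Field K] {R : CommRingCat.{u}} (φ : CommRingCat.of K ⟶ R) :
    Flat (Spec.map φ) := by
  rw [HasRingHomProperty.Spec_iff (P := @Flat)]
  exact RingHom.Flat.of_isField (Field.toIsField K) _

/-- `Spec` of a homomorphism from a field to a non-zero ring is surjective (`Spec` of a field
is a point). [folklore] -/
theorem surjective_SpecMap_of_field {K : Type u} [Field K] {R : CommRingCat.{u}} [Nontrivial R]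
    (φ : CommRingCat.of K ⟶ R) : Surjective (Spec.map φ) := by
  haveI : Nonempty ↥(Spec R) := inferInstanceAs (Nonempty (PrimeSpectrum R))
  refine ⟨fun p => ⟨Classical.arbitrary _, ?_⟩⟩
  exact Subsingleton.elim (α := PrimeSpectrum K) _ _

/-- The comparison morphism of `exists_isPullback_fiber_snd` is flat and surjective, and
integral when `ψ` is integral (`Spec κ(y') → Spec κ(ψ y')` is flat and surjective, and integral
by `Scheme.Hom.isIntegralHom_SpecMap_residueFieldMap`). [folklore] -/
theorem exists_fiber_snd_flat_surjective :
    ∃ π : (pullback.snd f ψ).fiber y' ⟶ f.fiber (ψ y'),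
      Flat π ∧ Surjective π ∧ (IsIntegralHom ψ → IsIntegralHom π) ∧
        π ≫ f.fiberι (ψ y') = (pullback.snd f ψ).fiberι y' ≫ pullback.fst f ψ := by
  obtain ⟨π, hπ, hcomp⟩ := exists_isPullback_fiber_snd f ψ y'
  have hflat : Flat (Spec.map (ψ.residueFieldMap y')) := flat_SpecMap_of_field _
  have hsurj : Surjective (Spec.map (ψ.residueFieldMap y')) := surjective_SpecMap_of_field _
  refine ⟨π, MorphismProperty.of_isPullback hπ.flip hflat,
    MorphismProperty.of_isPullback hπ.flip hsurj, fun hψ => ?_, hcomp⟩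
  haveI := hψ
  exact MorphismProperty.of_isPullback hπ.flip (Scheme.Hom.isIntegralHom_SpecMap_residueFieldMap ψ y')

end FiberSnd

/-! ## Consequences for `f' = ι ≫ pr_{Y'}` -/

section StrictTransformFibres

variable {X Y Y' X' : Scheme.{u}} (f : X ⟶ Y) (ψ : Y' ⟶ Y) (ι : X' ⟶ pullback f ψ)
  [IsClosedImmersion ι] [Surjective ι]

/-- **Equidimensionality of the fibres passes to `f' = ι ≫ pr_{Y'}`** (for `ψ` integral, e.g.
finite): if every irreducible component of every fibre of `f` has dimension `d`, then every
irreducible component of every fibre of `f'` has dimension `d` — the fibre of `f'` at `y'` is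
homeomorphic to the fibre of `pr_{Y'}`, which is flat, integral and surjective over the fibre of
`f` at `ψ y'`. [cite: StacksProject, Tag 0ECG (Lemma 29.45.9)] -/
theorem topologicalKrullDim_irreducibleComponents_fiber_comp_snd [IsIntegralHom ψ]
    {d : WithBot ℕ∞}
    (hf : ∀ (y : Y), ∀ C ∈ irreducibleComponents ↥(f.fiber y), topologicalKrullDim C = d)
    (y' : Y') :
    ∀ C' ∈ irreducibleComponents ↥((ι ≫ pullback.snd f ψ).fiber y'), topologicalKrullDim C' = d := by
  obtain ⟨π, hflat, -, hint, -⟩ := exists_fiber_snd_flat_surjective f ψ y'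
  haveI := hflat
  haveI := hint inferInstance
  have h1 : ∀ C ∈ irreducibleComponents ↥((pullback.snd f ψ).fiber y'), topologicalKrullDim C = d :=
    topologicalKrullDim_of_mem_irreducibleComponents_eq_of_flat_of_isIntegralHom π (hf (ψ y'))
  obtain ⟨m, hm, hms, -⟩ := exists_fiber_comp_of_isClosedImmersion ι (pullback.snd f ψ) y'
  haveI := hm
  haveI := hms
  exact IsHomeomorph.topologicalKrullDim_irreducibleComponents
    (isHomeomorph_of_isClosedImmersion_of_surjective m) h1

/-- **Density in the fibres passes to `f' = ι ≫ pr_{Y'}`**: for an open `W ⊆ X` whose trace on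
the fibre of `f` at `ψ y'` is dense (e.g. the smooth locus, (vi) b)), the trace of
`φ⁻¹(W) = ι⁻¹(pr_X⁻¹ W)` on the fibre of `f'` at `y'` is dense — pull back along the flat
comparison morphism (fibres of `f` being Noetherian) and the homeomorphism.
[cite: StacksProject, Tag 03HV (Lemma 29.25.9)] -/
theorem dense_preimage_fiberι_comp_snd (W : X.Opens)
    [∀ y : Y, NoetherianSpace ↥(f.fiber y)] (y' : Y')
    (hW : Dense ((f.fiberι (ψ y')) ⁻¹' (W : Set X))) :
    Dense (((ι ≫ pullback.snd f ψ).fiberι y') ⁻¹'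
      ((ι ≫ pullback.fst f ψ) ⁻¹' (W : Set X))) := by
  obtain ⟨π, hflat, -, -, hπ⟩ := exists_fiber_snd_flat_surjective f ψ y'
  haveI := hflat
  -- on the fibre of `pr_{Y'}`
  have h1 : Dense (((pullback.snd f ψ).fiberι y') ⁻¹' ((pullback.fst f ψ) ⁻¹' (W : Set X))) := by
    have hfun : ∀ z, pullback.fst f ψ (((pullback.snd f ψ).fiberι y') z) =
        f.fiberι (ψ y') (π z) := fun z => by
      rw [← Scheme.Hom.comp_apply, ← Scheme.Hom.comp_apply, hπ]
    have : ((pullback.snd f ψ).fiberι y') ⁻¹' ((pullback.fst f ψ) ⁻¹' (W : Set X)) =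
        π ⁻¹' ((f.fiberι (ψ y')) ⁻¹' (W : Set X)) := by
      ext z
      simp only [Set.mem_preimage, hfun]
    rw [this]
    exact dense_preimage_of_flat π ((f.fiberι (ψ y')).continuous.isOpen_preimage _ W.2) hW
  -- transport along the homeomorphism `(ι ≫ pr)_{y'} → pr_{y'}`
  obtain ⟨m, hm, hms, hmι⟩ := exists_fiber_comp_of_isClosedImmersion ι (pullback.snd f ψ) y'
  haveI := hm
  haveI := hms
  have hfun : ∀ z, (ι ≫ pullback.fst f ψ) (((ι ≫ pullback.snd f ψ).fiberι y') z) =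
      pullback.fst f ψ (((pullback.snd f ψ).fiberι y') (m z)) := fun z => by
    rw [← Scheme.Hom.comp_apply, ← Scheme.Hom.comp_apply, ← Scheme.Hom.comp_apply,
      ← Category.assoc m, hmι, Category.assoc]
  have : ((ι ≫ pullback.snd f ψ).fiberι y') ⁻¹' ((ι ≫ pullback.fst f ψ) ⁻¹' (W : Set X)) =
      m ⁻¹' (((pullback.snd f ψ).fiberι y') ⁻¹' ((pullback.fst f ψ) ⁻¹' (W : Set X))) := by
    ext z
    simp only [Set.mem_preimage, hfun]
  rw [this]
  exact IsHomeomorph.dense_preimage (isHomeomorph_of_isClosedImmersion_of_surjective m) h1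

/-- **`f' = ι ≫ pr_{Y'}` is geometrically connected if `f` is**: the base change of `f'` to a
field is homeomorphic (along a base change of `ι`) to that of `pr_{Y'}`, which is geometrically
connected as a base change of `f`. [cite: StacksProject, Tag 0362] -/
theorem geometricallyConnected_comp_of_isClosedImmersion_of_surjective {P S : Scheme.{u}}
    (ι : X' ⟶ P) [IsClosedImmersion ι] [Surjective ι] (p : P ⟶ S) [GeometricallyConnected p] :
    GeometricallyConnected (ι ≫ p) := by
  refine ⟨geometrically_iff_of_isClosedUnderIsomorphisms.mpr fun K _ x ↦ ?_⟩
  rw [← (pullbackRightPullbackFstIso p x ι).hom.homeomorph.connectedSpace_iff]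
  -- `pullback ι (pullback.fst p x) → pullback p x` is a surjective closed immersion
  haveI : ConnectedSpace ↥(pullback p x) :=
    GeometricallyConnected.geometrically_connectedSpace _ _ _ (.of_hasPullback _ _)
  exact ((isHomeomorph_of_isClosedImmersion_of_surjective
    (pullback.snd ι (pullback.fst p x))).homeomorph _).connectedSpace_iff.mpr inferInstance

end StrictTransformFibres

end Literature.AlgebraicGeometry.Resolution

end
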